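import Literature.Probability.LatticeModels.TemperleyLiebPercolationHead
import HarnessLib

/-!
# The planar Temperley–Lieb module at loop weight `1` is already generated, from any vector of non-zero total mass, by the generators AVOIDING THE LAST SITE («TL-PERCOLATION-HEAD-INITIAL»)

Topic `Literature/Probability/LatticeModels`; a rider on `TemperleyLiebPercolationHead.lean` («TL-PERCOLATION-HEAD»: `base m`, `totalMass`, the odd-staircase collapse,
`exists_minimal_chord`, the raising identity `connectSucc_connectSucc_eq`, `area_connectSucc_lt`, `LinkPattern.exists_moves_eq`, `eq_top_of_stable`). The same conclusion with
FEWER generators — the `2m` INITIAL generators `e_0, …, e_{2m−1}` of the `2m+2`-site planar module, i.e. without the generator `e_{2m}` acting on the last two sites (as a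
representation of `TL_{2m+1} ⊂ TL_{2m+2}` the module is the one-defect standard module; Ridout–Saint-Aubin's Prop. 3.3 applies to it too since its form is not identically zero):

* `LinkPattern.baseShift m` — the SHIFTED BASE pattern `{1,2}{3,4}⋯{2m−1,2m}{0,2m+1}`; `shiftStair` / ★★ `shiftStair_full` — **THE SHIFTED STAIRCASE `e_{2m−1} ⋯ e_3 e_1`
  (indices `< 2m` only) COLLAPSES EVERY LINK PATTERN ONTO `baseShift m`**; `collapseShift` / `collapseShift_apply` (`= ε(x) · δ_{baseShift}`);
* ★★ `LinkPattern.exists_lowering_moves` — every pattern is brought DOWN to `base m` by moves of index `≤ 2m − 2` (the lowering move at a minimal non-adjacent chord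
  `{a, c}` has index `a ≤ c − 3`); ★★ `LinkPattern.exists_moves_eq_bounded` — every pattern is reached UP from `base m` by moves of index `≤ 2m − 1` (the raising move has
  index `a + 1 ≤ c − 2`); hence ★★★ `LinkPattern.exists_moves_eq_initial` — **THE INITIAL GENERATORS ALONE ACT TRANSITIVELY** (from `baseShift` down to `base`, then up);
* ★★★ `eq_top_of_stable_initial` / `span_eq_top_of_stable_initial` / `le_ker_totalMass_of_stable_initial_of_ne_top` — **A SUBSPACE STABLE UNDER `e_0, …, e_{2m−1}` CONTAINING A
  VECTOR OF NON-ZERO TOTAL MASS IS THE WHOLE MODULE.**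

Why the lane wants it (`Percolation/MarkedLoopBoundaryLawModule.lean`, `…BoundarySpanCriterion.lean`): in the home-arc law `lawLP z` the boundary mid-edge `z` is the LAST site
(`closeUpRel`: `Fin.last k`), so the only generator whose geometric realisation involves `z` is the last one; with this file the stability criterion for boundary span needs
only the generators on pairs of CORNERS `(u_j, u_{j+1})`, `j ≤ k − 2` — exactly the pairs the hexagon-tower surgery handles (HOME `FINDING-BSPAN-TOWER-IDENTITY.md`).

## References
* D. Ridout, Y. Saint-Aubin, *Standard modules, induction and the structure of the Temperley–Lieb algebra*, Adv. Theor. Math. Phys. 18 (2014) = arXiv:1204.4505, §3 Prop. 3.3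
  (arXiv p. 13: cyclicity whenever the bilinear form is not identically zero; applies to the one-defect restriction).
* P. A. Pearce, V. Rittenberg, J. de Gier, B. Nienhuis, *Temperley–Lieb stochastic processes*, J. Phys. A 35 (2002) L661–L668, §2 ((monoid); the sectors `C_{L,m}`).

## Mathlib / tree
Tree: `TemperleyLiebPercolationHead.lean` (`LinkPattern.base`, `exists_minimal_chord`, `connectSucc_connectSucc_eq`, `area_connectSucc_lt`, `applyMoves`,
`applyMoves_append_singleton`, `totalMass`, `totalMass_single`, `tlL_one_single`, `eq_top_of_forall_single_mem`, `LinkPattern.connectSucc_partner_castSucc`,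
`LinkPattern.connectSucc_partner_of_ne`), `TemperleyLiebLinkPatterns.lean` (`PerfectMatching.ext`, `partner_partner`, `partner_ne`, `partner_inj`, `IsNonCrossing`).
Mathlib: `Nat.strong_induction_on`, `List.reverseRecOn`, `Finsupp.induction_linear`.
-/

namespace Literature.Probability.LatticeModels.TemperleyLieb

open Function Finset

/-! ### The shifted base pattern and the shifted staircase -/

section Shifted

variable (m : ℕ)

/-- the partner function of the shifted base: `2i+1 ↦ 2i+2`, `2i+2 ↦ 2i+1` (`i < m`), `0 ↦ 2m+1`, `2m+1 ↦ 0`. [cite: PearceRittenbergDeGierNienhuis2002, §2 (link patterns)] -/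
def baseShiftPartner (i : Fin (2 * m + 1 + 1)) : Fin (2 * m + 1 + 1) :=
  if h0 : i.val = 0 then ⟨2 * m + 1, by omega⟩
  else if h1 : i.val = 2 * m + 1 then ⟨0, by omega⟩
  else if h2 : i.val % 2 = 1 then ⟨i.val + 1, by have hi := i.2; omega⟩ else ⟨i.val - 1, by have hi := i.2; omega⟩

/-- its value. [cite: PearceRittenbergDeGierNienhuis2002, §2] -/
theorem baseShiftPartner_val (i : Fin (2 * m + 1 + 1)) : (baseShiftPartner m i).val =
    if i.val = 0 then 2 * m + 1 else if i.val = 2 * m + 1 then 0 else if i.val % 2 = 1 then i.val + 1 else i.val - 1 := by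
  unfold baseShiftPartner; split_ifs <;> rfl

/-- **the SHIFTED BASE pairing** `{1,2}{3,4}⋯{2m−1,2m}{0,2m+1}`. [cite: PearceRittenbergDeGierNienhuis2002, §2 (link patterns)] -/
def PerfectMatching.baseShift : PerfectMatching (2 * m + 1 + 1) where
  partner := baseShiftPartner m
  partner_partner i := by
    apply Fin.ext; rw [baseShiftPartner_val, baseShiftPartner_val]; have := i.2; split_ifs <;> first | contradiction | omega
  partner_ne i h := by
    have e := congrArg Fin.val h; rw [baseShiftPartner_val] at e; have := i.2; split_ifs at e <;> first | contradiction | omega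

/-- the shifted base is non-crossing (its only wide chord `{0, 2m+1}` contains everything). [cite: PearceRittenbergDeGierNienhuis2002, §2 (non-intersecting half-loops)] -/
theorem isNonCrossing_baseShift : IsNonCrossing (PerfectMatching.baseShift m) := by
  intro a b hab h1 h2
  have ea : ((PerfectMatching.baseShift m).partner a).val = _ := baseShiftPartner_val m a
  have eb : ((PerfectMatching.baseShift m).partner b).val = _ := baseShiftPartner_val m b
  rw [Fin.lt_def] at hab h1 h2 ⊢
  rw [Fin.lt_def]
  have hb := b.2; have ha := a.2
  split_ifs at ea eb <;> first | contradiction | omega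

/-- ★ **the SHIFTED BASE link pattern.** [cite: PearceRittenbergDeGierNienhuis2002, §2 (link patterns)] -/
def LinkPattern.baseShift : LinkPattern (2 * m + 1 + 1) := ⟨PerfectMatching.baseShift m, isNonCrossing_baseShift m⟩

/-- its partner function. [cite: PearceRittenbergDeGierNienhuis2002, §2] -/
theorem LinkPattern.baseShift_partner_val (i : Fin (2 * m + 1 + 1)) : ((LinkPattern.baseShift m).1.partner i).val =
    if i.val = 0 then 2 * m + 1 else if i.val = 2 * m + 1 then 0 else if i.val % 2 = 1 then i.val + 1 else i.val - 1 := baseShiftPartner_val m i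

/-- a link pattern pairing every ODD site `2i+1 < 2m+1` with its successor IS the shifted base (the two remaining sites `0`, `2m+1` pair with each other).
[cite: PearceRittenbergDeGierNienhuis2002, §2 (link patterns)] -/
theorem LinkPattern.eq_baseShift_of_odd (P : LinkPattern (2 * m + 1 + 1))
    (h : ∀ i : Fin (2 * m + 1 + 1), i.val % 2 = 1 → i.val < 2 * m + 1 → (P.1.partner i).val = i.val + 1) : P = LinkPattern.baseShift m := by
  -- first: the partner of `0` is `2m+1` (every other site is taken)
  have hlast : (P.1.partner ⟨0, by omega⟩).val = 2 * m + 1 := by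
    set y := P.1.partner ⟨0, by omega⟩ with hy
    have hy0 : y.val ≠ 0 := fun e => P.1.partner_ne ⟨0, by omega⟩ (Fin.ext e)
    by_contra hne
    have hy2 := y.2
    by_cases hodd : y.val % 2 = 1
    · have e1 : (P.1.partner y).val = y.val + 1 := h y hodd (by omega)
      have e2 : P.1.partner y = ⟨0, by omega⟩ := by rw [hy, P.1.partner_partner]
      rw [e2] at e1; change (0 : ℕ) = y.val + 1 at e1; omega
    · -- `y` even, `y ≥ 2`: its predecessor is odd `< 2m+1` and pairs with `y`
      let y' : Fin (2 * m + 1 + 1) := ⟨y.val - 1, by omega⟩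
      have e1 : (P.1.partner y').val = y'.val + 1 := h y' (by show (y.val - 1) % 2 = 1; omega) (by show y.val - 1 < 2 * m + 1; omega)
      have e2 : P.1.partner y' = y := Fin.ext (by rw [e1]; show y.val - 1 + 1 = y.val; omega)
      have e3 : P.1.partner y = y' := by rw [← e2, P.1.partner_partner]
      have e4 : P.1.partner y = ⟨0, by omega⟩ := by rw [hy, P.1.partner_partner]
      rw [e4] at e3; have := congrArg Fin.val e3; change (0 : ℕ) = y.val - 1 at this; omega
  apply Subtype.ext; apply PerfectMatching.ext; funext i; apply Fin.ext
  rw [LinkPattern.baseShift_partner_val]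
  have hi := i.2
  by_cases hi0 : i.val = 0
  · rw [if_pos hi0]; have : i = ⟨0, by omega⟩ := Fin.ext hi0; rw [this]; exact hlast
  rw [if_neg hi0]
  by_cases hiL : i.val = 2 * m + 1
  · rw [if_pos hiL]
    have e0 : P.1.partner ⟨0, by omega⟩ = i := Fin.ext (by rw [hlast, hiL])
    have : P.1.partner i = ⟨0, by omega⟩ := by rw [← e0, P.1.partner_partner]
    rw [this]
  rw [if_neg hiL]
  by_cases hodd : i.val % 2 = 1
  · rw [if_pos hodd]; exact h i hodd (by omega)
  · rw [if_neg hodd]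
    let i' : Fin (2 * m + 1 + 1) := ⟨i.val - 1, by omega⟩
    have e1 : (P.1.partner i').val = i'.val + 1 := h i' (by show (i.val - 1) % 2 = 1; omega) (by show i.val - 1 < 2 * m + 1; omega)
    have e2 : P.1.partner i' = i := Fin.ext (by rw [e1]; show i.val - 1 + 1 = i.val; omega)
    have : P.1.partner i = i' := by rw [← e2, P.1.partner_partner]
    rw [this]

/-- the odd site `2t+1` as a generator index (`t < m`, index `< 2m`). [cite: PearceRittenbergDeGierNienhuis2002, §2] -/
def oddGen (t : Fin m) : Fin (2 * m + 1) := ⟨2 * t.val + 1, by have := t.2; omega⟩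

/-- **the shifted staircase**: the moves at the odd sites `1, 3, …, 2t−1`. [cite: RidoutSaintAubin2014TL, §3 proof of Prop. 3.3 (arXiv p. 13)] -/
noncomputable def shiftStair (P : LinkPattern (2 * m + 1 + 1)) : ℕ → LinkPattern (2 * m + 1 + 1)
  | 0 => P
  | t + 1 => if h : t < m then (shiftStair P t).connectSucc (oddGen m ⟨t, h⟩) else shiftStair P t

/-- the recursion step. [cite: RidoutSaintAubin2014TL, §3 (arXiv p. 13)] -/
theorem shiftStair_succ (P : LinkPattern (2 * m + 1 + 1)) {t : ℕ} (h : t < m) :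
    shiftStair m P (t + 1) = (shiftStair m P t).connectSucc (oddGen m ⟨t, h⟩) := by
  rw [shiftStair, dif_pos h]

variable {m}

/-- ★ after `t` steps the odd sites `2i+1`, `i < t`, pair with their successors. [cite: RidoutSaintAubin2014TL, §3 (arXiv p. 13)] -/
theorem shiftStair_partner (P : LinkPattern (2 * m + 1 + 1)) :
    ∀ t : ℕ, t ≤ m → ∀ i : Fin (2 * m + 1 + 1), i.val % 2 = 1 → i.val < 2 * t → ((shiftStair m P t).1.partner i).val = i.val + 1 := by
  intro t
  induction t with
  | zero => intro _ i _ hi; omega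
  | succ t ih =>
    intro ht i hi hit
    have htm : t < m := by omega
    rw [shiftStair_succ m P htm]
    by_cases hnew : i.val = 2 * t + 1
    · have ei : i = Fin.castSucc (oddGen m ⟨t, htm⟩) := Fin.ext (by rw [Fin.val_castSucc]; exact hnew)
      rw [ei, LinkPattern.connectSucc_partner_castSucc, Fin.val_succ, Fin.val_castSucc]
    · have hlt : i.val < 2 * t := by omega
      have hold := ih (le_of_lt htm) i hi hlt
      have e1 : i ≠ Fin.castSucc (oddGen m ⟨t, htm⟩) := fun e => hnew (by rw [e, Fin.val_castSucc]; rfl)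
      have e2 : i ≠ (oddGen m ⟨t, htm⟩).succ := fun e => by
        have := congrArg Fin.val e; rw [Fin.val_succ] at this; change i.val = 2 * t + 1 + 1 at this; omega
      have e3 : (shiftStair m P t).1.partner i ≠ Fin.castSucc (oddGen m ⟨t, htm⟩) := fun e => by
        have := congrArg Fin.val e; rw [hold, Fin.val_castSucc] at this; change i.val + 1 = 2 * t + 1 at this; omega
      have e4 : (shiftStair m P t).1.partner i ≠ (oddGen m ⟨t, htm⟩).succ := fun e => by
        have := congrArg Fin.val e; rw [hold, Fin.val_succ] at this; change i.val + 1 = 2 * t + 1 + 1 at this; omega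
      rw [LinkPattern.connectSucc_partner_of_ne _ _ e1 e2 e3 e4, hold]

/-- ★★ **THE SHIFTED STAIRCASE `e_{2m−1} ⋯ e_3 e_1` COLLAPSES EVERY LINK PATTERN ONTO THE SHIFTED BASE** (generator indices `< 2m` only).
[cite: RidoutSaintAubin2014TL, §3 Prop. 3.3, proof (arXiv p. 13: `|x y| z = ⟨y, z⟩ x`); PearceRittenbergDeGierNienhuis2002, §2 (monoid)] -/
theorem shiftStair_full (P : LinkPattern (2 * m + 1 + 1)) : shiftStair m P m = LinkPattern.baseShift m :=
  LinkPattern.eq_baseShift_of_odd m _ fun i hi hlt => shiftStair_partner P m le_rfl i hi (by omega)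

variable (R : Type*) [CommRing R] (m)

/-- the shifted collapsing endomorphism `e_{2t−1} ∘ ⋯ ∘ e_1`. [cite: RidoutSaintAubin2014TL, §3 proof of Prop. 3.3 (arXiv p. 13)] -/
noncomputable def collapseShiftTo : ℕ → Module.End R (LinkPattern (2 * m + 1 + 1) →₀ R)
  | 0 => LinearMap.id
  | t + 1 => if h : t < m then tlL R 1 (oddGen m ⟨t, h⟩) ∘ₗ collapseShiftTo t else collapseShiftTo t

variable {R m}

/-- on basis vectors. [cite: RidoutSaintAubin2014TL, §3 (arXiv p. 13)] -/
theorem collapseShiftTo_single (P : LinkPattern (2 * m + 1 + 1)) (c : R) : ∀ t : ℕ, collapseShiftTo m R t (Finsupp.single P c) = Finsupp.single (shiftStair m P t) c := by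
  intro t
  induction t with
  | zero => rfl
  | succ t ih =>
    show (collapseShiftTo m R (t + 1)) (Finsupp.single P c) = Finsupp.single (shiftStair m P (t + 1)) c
    rw [collapseShiftTo, shiftStair]
    split_ifs with h
    · rw [LinearMap.comp_apply, ih, tlL_one_single]
    · exact ih

/-- ★★ `collapseShiftTo m x = ε(x) · δ_{baseShift}`. [cite: RidoutSaintAubin2014TL, §3 Prop. 3.3, proof (arXiv p. 13)] -/
theorem collapseShift_apply (x : LinkPattern (2 * m + 1 + 1) →₀ R) : collapseShiftTo m R m x = totalMass R x • Finsupp.single (LinkPattern.baseShift m) 1 := by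
  induction x using Finsupp.induction_linear with
  | zero => rw [map_zero, map_zero, zero_smul]
  | add x y hx hy => rw [map_add, map_add, hx, hy, add_smul]
  | single P c => rw [collapseShiftTo_single, shiftStair_full, totalMass_single, Finsupp.smul_single_one]

/-- the shifted partial words stay in a subspace stable under the INITIAL generators (index `< 2m`). [cite: RidoutSaintAubin2014TL, §3 (arXiv p. 13)] -/
theorem collapseShiftTo_mem {W : Submodule R (LinkPattern (2 * m + 1 + 1) →₀ R)}
    (hW : ∀ (j : Fin (2 * m + 1)), j.val < 2 * m → ∀ w, w ∈ W → tlL R 1 j w ∈ W) {x : LinkPattern (2 * m + 1 + 1) →₀ R} (hx : x ∈ W) :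
    ∀ t : ℕ, collapseShiftTo m R t x ∈ W := by
  intro t
  induction t with
  | zero => exact hx
  | succ t ih =>
    show (collapseShiftTo m R (t + 1)) x ∈ W
    rw [collapseShiftTo]
    split_ifs with h
    · rw [LinearMap.comp_apply]; exact hW _ (by show 2 * t + 1 < 2 * m; omega) _ ih
    · exact ih

end Shifted

/-! ### Transitivity with bounded generator indices -/

namespace LinkPattern

variable {m : ℕ}

/-- ★★ **LOWERING**: every link pattern is brought down to the base pattern by moves of index `≤ 2m − 2` (at a minimal non-adjacent chord `{a, c}`, `c ≥ a + 3`, the lowering move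
is `e_a`, and `a ≤ 2m − 2`). [cite: PearceRittenbergDeGierNienhuis2002, §2 (monoid); RidoutSaintAubin2014TL, §3 (arXiv p. 13)] -/
theorem exists_lowering_moves (Q : LinkPattern (2 * m + 1 + 1)) :
    ∃ js : List (Fin (2 * m + 1)), (∀ j ∈ js, j.val + 2 ≤ 2 * m) ∧ Q.applyMoves js = base m := by
  have key : ∀ n : ℕ, ∀ Q : LinkPattern (2 * m + 1 + 1), Q.1.area = n →
      ∃ js : List (Fin (2 * m + 1)), (∀ j ∈ js, j.val + 2 ≤ 2 * m) ∧ Q.applyMoves js = base m := by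
    intro n
    induction n using Nat.strong_induction_on with
    | _ n ih =>
      intro Q hQn
      by_cases hQ : Q = base m
      · exact ⟨[], fun _ h => by simp at h, by rw [applyMoves_nil, hQ]⟩
      · obtain ⟨a, b, d, c, hb, hd, hc3, hQa, hQb⟩ := exists_minimal_chord hQ
        have hc := c.2
        let j₁ : Fin (2 * m + 1) := ⟨a.val, by omega⟩
        have hlt : (Q.connectSucc j₁).1.area < n := by rw [← hQn]; exact area_connectSucc_lt Q hb hd hc3 hQa hQb j₁ rfl
        obtain ⟨js, hjs, hend⟩ := ih _ hlt (Q.connectSucc j₁) rfl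
        refine ⟨j₁ :: js, fun j hj => ?_, ?_⟩
        · rcases List.mem_cons.1 hj with rfl | hj
          · show a.val + 2 ≤ 2 * m; omega
          · exact hjs j hj
        · show ((j₁ :: js).foldl (fun P j => P.connectSucc j) Q) = base m
          rw [List.foldl_cons]
          exact hend
  exact key _ Q rfl

/-- ★★ **RAISING WITH BOUNDED INDICES**: every link pattern is reached from the base pattern by moves of index `≤ 2m − 1` (the raising move `e_{a+1}` at a minimal chord has
`a + 1 ≤ c − 2 ≤ 2m − 1`). [cite: RidoutSaintAubin2014TL, §3 Prop. 3.3 (arXiv p. 13); PearceRittenbergDeGierNienhuis2002, §2 (monoid)] -/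
theorem exists_moves_eq_bounded (Q : LinkPattern (2 * m + 1 + 1)) :
    ∃ js : List (Fin (2 * m + 1)), (∀ j ∈ js, j.val + 1 ≤ 2 * m) ∧ (base m).applyMoves js = Q := by
  have key : ∀ n : ℕ, ∀ Q : LinkPattern (2 * m + 1 + 1), Q.1.area = n →
      ∃ js : List (Fin (2 * m + 1)), (∀ j ∈ js, j.val + 1 ≤ 2 * m) ∧ (base m).applyMoves js = Q := by
    intro n
    induction n using Nat.strong_induction_on with
    | _ n ih =>
      intro Q hQn
      by_cases hQ : Q = base m
      · exact ⟨[], fun _ h => by simp at h, by rw [applyMoves_nil, hQ]⟩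
      · obtain ⟨a, b, d, c, hb, hd, hc3, hQa, hQb⟩ := exists_minimal_chord hQ
        have hc := c.2
        let j₁ : Fin (2 * m + 1) := ⟨a.val, by omega⟩
        let j₂ : Fin (2 * m + 1) := ⟨a.val + 1, by omega⟩
        have hlt : (Q.connectSucc j₁).1.area < n := by rw [← hQn]; exact area_connectSucc_lt Q hb hd hc3 hQa hQb j₁ rfl
        obtain ⟨js, hjs, hend⟩ := ih _ hlt (Q.connectSucc j₁) rfl
        refine ⟨js ++ [j₂], fun j hj => ?_, ?_⟩
        · rcases List.mem_append.1 hj with hj | hj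
          · exact hjs j hj
          · rw [List.mem_singleton] at hj; rw [hj]; show a.val + 1 + 1 ≤ 2 * m; omega
        · rw [applyMoves_append_singleton, hend]
          exact connectSucc_connectSucc_eq Q hb hd hc3 hQa hQb j₁ j₂ rfl rfl
  exact key _ Q rfl

/-- ★★★ **THE INITIAL GENERATORS ACT TRANSITIVELY**: every link pattern is reached from the shifted base by moves of index `< 2m` (down to `base`, then up).
[cite: RidoutSaintAubin2014TL, §3 Prop. 3.3 (arXiv p. 13: cyclicity); PearceRittenbergDeGierNienhuis2002, §2 (monoid)] -/
theorem exists_moves_eq_initial (Q : LinkPattern (2 * m + 1 + 1)) :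
    ∃ js : List (Fin (2 * m + 1)), (∀ j ∈ js, j.val < 2 * m) ∧ (baseShift m).applyMoves js = Q := by
  obtain ⟨js₁, h₁, e₁⟩ := (baseShift m).exists_lowering_moves
  obtain ⟨js₂, h₂, e₂⟩ := Q.exists_moves_eq_bounded
  refine ⟨js₁ ++ js₂, fun j hj => ?_, ?_⟩
  · rcases List.mem_append.1 hj with hj | hj
    · have := h₁ j hj; omega
    · have := h₂ j hj; omega
  · unfold applyMoves at e₁ e₂ ⊢
    rw [List.foldl_append, e₁, e₂]

end LinkPattern

/-! ### The head with the initial generators only -/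

section HeadInitial

variable {R : Type*} [CommRing R] {m : ℕ}

/-- a subspace stable under the initial generators and containing `δ_P` contains `δ_{P · w}` for every word `w` of index `< 2m`. [cite: PearceRittenbergDeGierNienhuis2002, §2 (monoid)] -/
theorem single_applyMoves_mem_of_stable_initial {W : Submodule R (LinkPattern (2 * m + 1 + 1) →₀ R)}
    (hW : ∀ (j : Fin (2 * m + 1)), j.val < 2 * m → ∀ w, w ∈ W → tlL R 1 j w ∈ W) {P : LinkPattern (2 * m + 1 + 1)}
    (hP : Finsupp.single P (1 : R) ∈ W) (js : List (Fin (2 * m + 1))) (hjs : ∀ j ∈ js, j.val < 2 * m) :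
    Finsupp.single (P.applyMoves js) (1 : R) ∈ W := by
  induction js using List.reverseRecOn with
  | nil => rw [LinkPattern.applyMoves_nil]; exact hP
  | append_singleton js j ih =>
    rw [LinkPattern.applyMoves_append_singleton, ← tlL_one_single]
    exact hW j (hjs j (List.mem_append.2 (Or.inr (List.mem_singleton.2 rfl)))) _
      (ih fun j' hj' => hjs j' (List.mem_append.2 (Or.inl hj')))

variable {K : Type*} [Field K]

/-- ★★★ **THE HEAD LEMMA WITH THE INITIAL GENERATORS**: a subspace of the planar module of `2m+2` sites (over a field) stable under `e_0, …, e_{2m−1}` and containing a vector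
of non-zero total mass is the whole module. [cite: RidoutSaintAubin2014TL, §3 Prop. 3.3 and proof (arXiv p. 13); PearceRittenbergDeGierNienhuis2002, §2] -/
theorem eq_top_of_stable_initial {W : Submodule K (LinkPattern (2 * m + 1 + 1) →₀ K)}
    (hW : ∀ (j : Fin (2 * m + 1)), j.val < 2 * m → ∀ w, w ∈ W → tlL K 1 j w ∈ W)
    {x : LinkPattern (2 * m + 1 + 1) →₀ K} (hx : x ∈ W) (hmass : totalMass K x ≠ 0) : W = ⊤ := by
  -- the shifted base is in `W`
  have hc : collapseShiftTo m K m x ∈ W := collapseShiftTo_mem hW hx m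
  rw [collapseShift_apply] at hc
  have hbase : Finsupp.single (LinkPattern.baseShift m) (1 : K) ∈ W := by
    have := W.smul_mem (totalMass K x)⁻¹ hc
    rwa [smul_smul, inv_mul_cancel₀ hmass, one_smul] at this
  -- hence every pattern
  refine eq_top_of_forall_single_mem fun Q => ?_
  obtain ⟨js, hjs, e⟩ := Q.exists_moves_eq_initial
  rw [← e]
  exact single_applyMoves_mem_of_stable_initial hW hbase js hjs

/-- ★★ every proper subspace stable under the initial generators lies in the hyperplane `ker ε`. [cite: RidoutSaintAubin2014TL, §3 Prop. 3.3 (arXiv p. 13)] -/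
theorem le_ker_totalMass_of_stable_initial_of_ne_top {W : Submodule K (LinkPattern (2 * m + 1 + 1) →₀ K)}
    (hW : ∀ (j : Fin (2 * m + 1)), j.val < 2 * m → ∀ w, w ∈ W → tlL K 1 j w ∈ W) (hne : W ≠ ⊤) : W ≤ LinearMap.ker (totalMass K) := by
  intro x hx
  rw [LinearMap.mem_ker]
  by_contra hmass
  exact hne (eq_top_of_stable_initial hW hx hmass)

/-- ★★ **span form**: the span of a family stable under the initial generators and containing one vector of non-zero total mass is everything.
[cite: RidoutSaintAubin2014TL, §3 Prop. 3.3 (arXiv p. 13)] -/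
theorem span_eq_top_of_stable_initial {ι : Type*} (f : ι → LinkPattern (2 * m + 1 + 1) →₀ K)
    (hstab : ∀ (j : Fin (2 * m + 1)), j.val < 2 * m → ∀ i : ι, tlL K 1 j (f i) ∈ Submodule.span K (Set.range f)) {i₀ : ι} (hmass : totalMass K (f i₀) ≠ 0) :
    Submodule.span K (Set.range f) = ⊤ := by
  refine eq_top_of_stable_initial (W := Submodule.span K (Set.range f)) ?_ (Submodule.subset_span ⟨i₀, rfl⟩) hmass
  intro j hj w hw
  refine Submodule.span_induction ?_ ?_ ?_ ?_ hw
  · rintro _ ⟨i, rfl⟩; exact hstab j hj i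
  · rw [map_zero]; exact Submodule.zero_mem _
  · intro x y _ _ hx hy; rw [map_add]; exact Submodule.add_mem _ hx hy
  · intro c x _ hx; rw [map_smul]; exact Submodule.smul_mem _ c hx

end HeadInitial

end Literature.Probability.LatticeModels.TemperleyLieb
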